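import Summits.BirchSwinnertonDyer.BirchSwinnertonDyer.Theorems.Rank2ObservatoryTateDeepCert
import Literature.NumberTheory.EllipticCurves.TamagawaRingEquivProofs
import Literature.NumberTheory.EllipticCurves.NeronComponentIndexProofs
import Literature.NumberTheory.EllipticCurves.NeronComponentIndexTypeIIIProofs
import Literature.NumberTheory.EllipticCurves.NeronComponentIndexTypeIIIstarProofs
import Literature.NumberTheory.EllipticCurves.NeronComponentIndexTypeIVProofs
import Literature.NumberTheory.EllipticCurves.NeronComponentIndexTypeIVstarProofs
import Literature.NumberTheory.EllipticCurves.HasseWeilAbelianConductor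
import Summits.BirchSwinnertonDyer.BirchSwinnertonDyer.Theorems.KatoDescentTamePotSupersingularTameUpperUnitTwistRecordsSharp01
import Summits.BirchSwinnertonDyer.BirchSwinnertonDyer.Theorems.KatoDescentTamePotSupersingularTameUpperUnitTwistRecordsSharp02
import Summits.BirchSwinnertonDyer.BirchSwinnertonDyer.Theorems.KatoDescentTamePotSupersingularTameUpperUnitTwistRecordsSharp04
import Summits.BirchSwinnertonDyer.BirchSwinnertonDyer.Theorems.KatoDescentTamePotSupersingularTameUpperUnitTwistRecordsSharp05
import Summits.BirchSwinnertonDyer.BirchSwinnertonDyer.Theorems.KatoDescentTamePotSupersingularTameUpperUnitTwistRecordsSharp24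
import Summits.BirchSwinnertonDyer.BirchSwinnertonDyer.Theorems.KatoDescentTamePotSupersingularTameUpperUnitTwistRecordsSharp27
import Summits.BirchSwinnertonDyer.BirchSwinnertonDyer.Theorems.KatoDescentTamePotSupersingularTameUpperUnitTwistRecordsSharp28
import Summits.BirchSwinnertonDyer.BirchSwinnertonDyer.Theorems.KatoDescentTamePotSupersingularTameUpperUnitTwistRecordsSharp29
import HarnessLib

/-!
# Route `KatoDescentTamePotSupersingular` (rung K8, sub-rung B4 (t′), cell `bsd-potss`): KERNEL certificates of the ♯ records'
# displayed binder `hcp : ¬ p ∣ c_p(E)` (part 06: 10 rows — 6050v1, 6498m1, 6498o1, 70400h1, 79200g1, 80802j1, 86700bq1, 86700bv1, 93100bb1, 93600de1)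
# (seat `bsd-potss-k8t-c4` g15; `--supports stmt-BirchSwinnertonDyer-19982 --as helper`)

HONEST FRAMING. THEOREMS ONLY; PER ROW; nothing is booked; items 19202 / 19982 stay OPEN at class level; BSD is not proved by any of
this. The ♯ unit-twist records (`…RecordsSharpNN`, g14) display `hcp : ¬ p ∣ (W.baseChange ℚ_[p]).localTamagawaNumber ℤ_[p]` — the
v ∣ p Selmer step of the Jetchev road needs `p ∤ c_p`. Here it is PROVED per row: the Kodaira type at the item prime `p` (the (t′) types
`II/III/IV/IV*/III*/II*`, `e = 6/4/3`) is certified by the rank-2 observatory's integer-model certificates (`Rank2ObservatoryTateStep2Cert.sound`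
for II/III/IV, `Rank2ObservatoryTateDeepCert.sound` for IV*/III*/II*, `check` by `decide`, minimality from `ord Δ < 12` resp. the row's
`isGloballyMinimal_g…`), and the tree's DISCHARGED Tate-step facts (`NeronComponentIndex*Proofs`: `c = 1` for II/II*, `2` for III/III*,
`∈ {1,3}` for IV/IV*) give `p ∤ c_p` for the odd `p`; `localTamagawaNumber_padic_eq_holds` moves the adèlic local number to Mathlib's `ℚ_p`.

References: [SilvermanATAEC1994] IV.9.4 Steps 3–10, Rem. IV.9.3, Table 4.1; [SilvermanAEC2009] VII.6; [Cremona2006] Table 1.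
-/

set_option autoImplicit false
set_option linter.dupNamespace false
noncomputable section
open scoped Classical NumberField
open WeierstrassCurve WeierstrassCurve.Rat IsDedekindDomain Rat.HeightOneSpectrum Literature.NumberTheory.DiophantineGeometry
  Literature.NumberTheory.EllipticCurves Literature.NumberTheory.EllipticCurves.Rank1Residual
  Summit.BirchSwinnertonDyer.BirchSwinnertonDyer.Rank1Residual.IntModel
  Summit.BirchSwinnertonDyer.Rank1Residual Summit.BirchSwinnertonDyer.Rank1Residual.Additive
  Summit.BirchSwinnertonDyer.BirchSwinnertonDyer
  Summit.BirchSwinnertonDyer.BirchSwinnertonDyer.Theorems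

namespace Summit.BirchSwinnertonDyer.BirchSwinnertonDyer.Theorems.TameUpperUnitTwistRecords

/-- **`6050v1`: `5 ∤ c_5(E)`** — the ♯ record's displayed binder `hcp` as a THEOREM: Kodaira type `II` at `5` (observatory certificate
`Step2Cert.sound` on the integer model, `decide`), hence `c_5 = 1` by the tree's discharged Tate-step fact
`localTamagawaNumber_eq_one_of_kodairaSymbolAt_eq_II`, read in Mathlib's `ℚ_5` via `localTamagawaNumber_padic_eq_holds`. [cite: SilvermanATAEC1994, IV.9.4 and Rem. IV.9.3]
[cite: Cremona2006, Table 1 (Cremona label 6050v1)] -/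
theorem localTamagawaNumber_not_dvd_g6050v1_5 : haveI := isElliptic_g6050v1;
    ¬ 5 ∣ ((⟨1, (-1), 1, (-2080), (-74973)⟩ : WeierstrassCurve ℚ).baseChange ℚ_[5]).localTamagawaNumber ℤ_[5] := by
  haveI := isElliptic_g6050v1
  haveI := isGloballyMinimal_g6050v1
  have hb : (⟨1, (-1), 1, (-2080), (-74973)⟩ : WeierstrassCurve ℤ).baseChange ℚ = (⟨1, (-1), 1, (-2080), (-74973)⟩ : WeierstrassCurve ℚ) := by
    ext <;> norm_num [WeierstrassCurve.baseChange, WeierstrassCurve.map]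
  set v : HeightOneSpectrum (𝓞 ℚ) := (primesEquiv (R := 𝓞 ℚ)).symm ⟨5, by norm_num⟩ with hvdef
  have hv : ((primesEquiv v : Nat.Primes) : ℕ) = 5 := by rw [hvdef, Equiv.apply_symm_apply]
  have hgen : natGenerator v = 5 := hv
  haveI := perfectField_residueField_adicCompletionIntegers (K := ℚ) v
  have hK : (⟨1, (-1), 1, (-2080), (-74973)⟩ : WeierstrassCurve ℚ).kodairaSymbolAt v = .II := by
    have h := (Rank2Observatory.Tate.Step2Cert.sound (W₀ := (⟨1, (-1), 1, (-2080), (-74973)⟩ : WeierstrassCurve ℤ)) (c := ⟨5, 4, 0, 0, 2, 2, 0⟩) v hgen (by decide +kernel)).1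
    rw [hb] at h
    exact h.trans (by decide)
  rw [localTamagawaNumber_padic_eq_holds (⟨1, (-1), 1, (-2080), (-74973)⟩ : WeierstrassCurve ℚ) v 5 hv, localTamagawaNumber_eq_one_of_kodairaSymbolAt_eq_II_holds v _ hK]
  decide

/-- **`6498m1`: `3 ∤ c_3(E)`** — the ♯ record's displayed binder `hcp` as a THEOREM: Kodaira type `III*` at `3` (observatory certificate
`DeepCert.sound` on the integer model, `decide`), hence `c_3 = 2` by the tree's discharged Tate-step fact
`localTamagawaNumber_eq_two_of_kodairaSymbolAt_eq_IIIstar`, read in Mathlib's `ℚ_3` via `localTamagawaNumber_padic_eq_holds`. [cite: SilvermanATAEC1994, IV.9.4 and Rem. IV.9.3]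
[cite: Cremona2006, Table 1 (Cremona label 6498m1)] -/
theorem localTamagawaNumber_not_dvd_g6498m1_3 : haveI := isElliptic_g6498m1;
    ¬ 3 ∣ ((⟨1, (-1), 1, (-1379), (-18845)⟩ : WeierstrassCurve ℚ).baseChange ℚ_[3]).localTamagawaNumber ℤ_[3] := by
  haveI := isElliptic_g6498m1
  haveI := isGloballyMinimal_g6498m1
  have hb : (⟨1, (-1), 1, (-1379), (-18845)⟩ : WeierstrassCurve ℤ).baseChange ℚ = (⟨1, (-1), 1, (-1379), (-18845)⟩ : WeierstrassCurve ℚ) := by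
    ext <;> norm_num [WeierstrassCurve.baseChange, WeierstrassCurve.map]
  set v : HeightOneSpectrum (𝓞 ℚ) := (primesEquiv (R := 𝓞 ℚ)).symm ⟨3, by norm_num⟩ with hvdef
  have hv : ((primesEquiv v : Nat.Primes) : ℕ) = 3 := by rw [hvdef, Equiv.apply_symm_apply]
  have hgen : natGenerator v = 3 := hv
  haveI := perfectField_residueField_adicCompletionIntegers (K := ℚ) v
  have hGM : ((⟨1, (-1), 1, (-1379), (-18845)⟩ : WeierstrassCurve ℤ).baseChange ℚ).IsGloballyMinimal := hb ▸ isGloballyMinimal_g6498m1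
  have hK : (⟨1, (-1), 1, (-1379), (-18845)⟩ : WeierstrassCurve ℚ).kodairaSymbolAt v = .IIIstar := by
    have h := (Rank2Observatory.Tate.DeepCert.sound (W₀ := (⟨1, (-1), 1, (-1379), (-18845)⟩ : WeierstrassCurve ℤ)) (c := ⟨3, 7, 1, 23, 9, 9, 0⟩) v hgen (hGM.isMinimal v) (by decide +kernel)).1
    rw [hb] at h
    exact h.trans (by decide)
  rw [localTamagawaNumber_padic_eq_holds (⟨1, (-1), 1, (-1379), (-18845)⟩ : WeierstrassCurve ℚ) v 3 hv, localTamagawaNumber_eq_two_of_kodairaSymbolAt_eq_IIIstar_holds v _ hK]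
  decide

/-- **`6498o1`: `3 ∤ c_3(E)`** — the ♯ record's displayed binder `hcp` as a THEOREM: Kodaira type `III` at `3` (observatory certificate
`Step2Cert.sound` on the integer model, `decide`), hence `c_3 = 2` by the tree's discharged Tate-step fact
`localTamagawaNumber_eq_two_of_kodairaSymbolAt_eq_III`, read in Mathlib's `ℚ_3` via `localTamagawaNumber_padic_eq_holds`. [cite: SilvermanATAEC1994, IV.9.4 and Rem. IV.9.3]
[cite: Cremona2006, Table 1 (Cremona label 6498o1)] -/
theorem localTamagawaNumber_not_dvd_g6498o1_3 : haveI := isElliptic_g6498o1;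
    ¬ 3 ∣ ((⟨1, (-1), 1, (-55301), (-4860995)⟩ : WeierstrassCurve ℚ).baseChange ℚ_[3]).localTamagawaNumber ℤ_[3] := by
  haveI := isElliptic_g6498o1
  haveI := isGloballyMinimal_g6498o1
  have hb : (⟨1, (-1), 1, (-55301), (-4860995)⟩ : WeierstrassCurve ℤ).baseChange ℚ = (⟨1, (-1), 1, (-55301), (-4860995)⟩ : WeierstrassCurve ℚ) := by
    ext <;> norm_num [WeierstrassCurve.baseChange, WeierstrassCurve.map]
  set v : HeightOneSpectrum (𝓞 ℚ) := (primesEquiv (R := 𝓞 ℚ)).symm ⟨3, by norm_num⟩ with hvdef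
  have hv : ((primesEquiv v : Nat.Primes) : ℕ) = 3 := by rw [hvdef, Equiv.apply_symm_apply]
  have hgen : natGenerator v = 3 := hv
  haveI := perfectField_residueField_adicCompletionIntegers (K := ℚ) v
  have hK : (⟨1, (-1), 1, (-55301), (-4860995)⟩ : WeierstrassCurve ℚ).kodairaSymbolAt v = .III := by
    have h := (Rank2Observatory.Tate.Step2Cert.sound (W₀ := (⟨1, (-1), 1, (-55301), (-4860995)⟩ : WeierstrassCurve ℤ)) (c := ⟨3, 1, 0, 2, 3, 3, 2⟩) v hgen (by decide +kernel)).1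
    rw [hb] at h
    exact h.trans (by decide)
  rw [localTamagawaNumber_padic_eq_holds (⟨1, (-1), 1, (-55301), (-4860995)⟩ : WeierstrassCurve ℚ) v 3 hv, localTamagawaNumber_eq_two_of_kodairaSymbolAt_eq_III_holds v _ hK]
  decide

/-- **`70400h1`: `5 ∤ c_5(E)`** — the ♯ record's displayed binder `hcp` as a THEOREM: Kodaira type `II` at `5` (observatory certificate
`Step2Cert.sound` on the integer model, `decide`), hence `c_5 = 1` by the tree's discharged Tate-step fact
`localTamagawaNumber_eq_one_of_kodairaSymbolAt_eq_II`, read in Mathlib's `ℚ_5` via `localTamagawaNumber_padic_eq_holds`. [cite: SilvermanATAEC1994, IV.9.4 and Rem. IV.9.3]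
[cite: Cremona2006, Table 1 (Cremona label 70400h1)] -/
theorem localTamagawaNumber_not_dvd_g70400h1_5 : haveI := isElliptic_g70400h1;
    ¬ 5 ∣ ((⟨0, 0, 0, (-3800), (-91840)⟩ : WeierstrassCurve ℚ).baseChange ℚ_[5]).localTamagawaNumber ℤ_[5] := by
  haveI := isElliptic_g70400h1
  haveI := isGloballyMinimal_g70400h1
  have hb : (⟨0, 0, 0, (-3800), (-91840)⟩ : WeierstrassCurve ℤ).baseChange ℚ = (⟨0, 0, 0, (-3800), (-91840)⟩ : WeierstrassCurve ℚ) := by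
    ext <;> norm_num [WeierstrassCurve.baseChange, WeierstrassCurve.map]
  set v : HeightOneSpectrum (𝓞 ℚ) := (primesEquiv (R := 𝓞 ℚ)).symm ⟨5, by norm_num⟩ with hvdef
  have hv : ((primesEquiv v : Nat.Primes) : ℕ) = 5 := by rw [hvdef, Equiv.apply_symm_apply]
  have hgen : natGenerator v = 5 := hv
  haveI := perfectField_residueField_adicCompletionIntegers (K := ℚ) v
  have hK : (⟨0, 0, 0, (-3800), (-91840)⟩ : WeierstrassCurve ℚ).kodairaSymbolAt v = .II := by
    have h := (Rank2Observatory.Tate.Step2Cert.sound (W₀ := (⟨0, 0, 0, (-3800), (-91840)⟩ : WeierstrassCurve ℤ)) (c := ⟨5, 0, 0, 0, 2, 2, 0⟩) v hgen (by decide +kernel)).1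
    rw [hb] at h
    exact h.trans (by decide)
  rw [localTamagawaNumber_padic_eq_holds (⟨0, 0, 0, (-3800), (-91840)⟩ : WeierstrassCurve ℚ) v 5 hv, localTamagawaNumber_eq_one_of_kodairaSymbolAt_eq_II_holds v _ hK]
  decide

/-- **`79200g1`: `3 ∤ c_3(E)`** — the ♯ record's displayed binder `hcp` as a THEOREM: Kodaira type `III*` at `3` (observatory certificate
`DeepCert.sound` on the integer model, `decide`), hence `c_3 = 2` by the tree's discharged Tate-step fact
`localTamagawaNumber_eq_two_of_kodairaSymbolAt_eq_IIIstar`, read in Mathlib's `ℚ_3` via `localTamagawaNumber_padic_eq_holds`. [cite: SilvermanATAEC1994, IV.9.4 and Rem. IV.9.3]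
[cite: Cremona2006, Table 1 (Cremona label 79200g1)] -/
theorem localTamagawaNumber_not_dvd_g79200g1_3 : haveI := isElliptic_g79200g1;
    ¬ 3 ∣ ((⟨0, 0, 0, (-299025), (-62937000)⟩ : WeierstrassCurve ℚ).baseChange ℚ_[3]).localTamagawaNumber ℤ_[3] := by
  haveI := isElliptic_g79200g1
  haveI := isGloballyMinimal_g79200g1
  have hb : (⟨0, 0, 0, (-299025), (-62937000)⟩ : WeierstrassCurve ℤ).baseChange ℚ = (⟨0, 0, 0, (-299025), (-62937000)⟩ : WeierstrassCurve ℚ) := by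
    ext <;> norm_num [WeierstrassCurve.baseChange, WeierstrassCurve.map]
  set v : HeightOneSpectrum (𝓞 ℚ) := (primesEquiv (R := 𝓞 ℚ)).symm ⟨3, by norm_num⟩ with hvdef
  have hv : ((primesEquiv v : Nat.Primes) : ℕ) = 3 := by rw [hvdef, Equiv.apply_symm_apply]
  have hgen : natGenerator v = 3 := hv
  haveI := perfectField_residueField_adicCompletionIntegers (K := ℚ) v
  have hGM : ((⟨0, 0, 0, (-299025), (-62937000)⟩ : WeierstrassCurve ℤ).baseChange ℚ).IsGloballyMinimal := hb ▸ isGloballyMinimal_g79200g1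
  have hK : (⟨0, 0, 0, (-299025), (-62937000)⟩ : WeierstrassCurve ℚ).kodairaSymbolAt v = .IIIstar := by
    have h := (Rank2Observatory.Tate.DeepCert.sound (W₀ := (⟨0, 0, 0, (-299025), (-62937000)⟩ : WeierstrassCurve ℤ)) (c := ⟨3, 0, 0, 0, 9, 9, 0⟩) v hgen (hGM.isMinimal v) (by decide +kernel)).1
    rw [hb] at h
    exact h.trans (by decide)
  rw [localTamagawaNumber_padic_eq_holds (⟨0, 0, 0, (-299025), (-62937000)⟩ : WeierstrassCurve ℚ) v 3 hv, localTamagawaNumber_eq_two_of_kodairaSymbolAt_eq_IIIstar_holds v _ hK]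
  decide

/-- **`80802j1`: `3 ∤ c_3(E)`** — the ♯ record's displayed binder `hcp` as a THEOREM: Kodaira type `III` at `3` (observatory certificate
`Step2Cert.sound` on the integer model, `decide`), hence `c_3 = 2` by the tree's discharged Tate-step fact
`localTamagawaNumber_eq_two_of_kodairaSymbolAt_eq_III`, read in Mathlib's `ℚ_3` via `localTamagawaNumber_padic_eq_holds`. [cite: SilvermanATAEC1994, IV.9.4 and Rem. IV.9.3]
[cite: Cremona2006, Table 1 (Cremona label 80802j1)] -/
theorem localTamagawaNumber_not_dvd_g80802j1_3 : haveI := isElliptic_g80802j1;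
    ¬ 3 ∣ ((⟨1, (-1), 1, (-620324), 379877767⟩ : WeierstrassCurve ℚ).baseChange ℚ_[3]).localTamagawaNumber ℤ_[3] := by
  haveI := isElliptic_g80802j1
  haveI := isGloballyMinimal_g80802j1
  have hb : (⟨1, (-1), 1, (-620324), 379877767⟩ : WeierstrassCurve ℤ).baseChange ℚ = (⟨1, (-1), 1, (-620324), 379877767⟩ : WeierstrassCurve ℚ) := by
    ext <;> norm_num [WeierstrassCurve.baseChange, WeierstrassCurve.map]
  set v : HeightOneSpectrum (𝓞 ℚ) := (primesEquiv (R := 𝓞 ℚ)).symm ⟨3, by norm_num⟩ with hvdef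
  have hv : ((primesEquiv v : Nat.Primes) : ℕ) = 3 := by rw [hvdef, Equiv.apply_symm_apply]
  have hgen : natGenerator v = 3 := hv
  haveI := perfectField_residueField_adicCompletionIntegers (K := ℚ) v
  have hK : (⟨1, (-1), 1, (-620324), 379877767⟩ : WeierstrassCurve ℚ).kodairaSymbolAt v = .III := by
    have h := (Rank2Observatory.Tate.Step2Cert.sound (W₀ := (⟨1, (-1), 1, (-620324), 379877767⟩ : WeierstrassCurve ℤ)) (c := ⟨3, 1, 0, 2, 3, 3, 2⟩) v hgen (by decide +kernel)).1
    rw [hb] at h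
    exact h.trans (by decide)
  rw [localTamagawaNumber_padic_eq_holds (⟨1, (-1), 1, (-620324), 379877767⟩ : WeierstrassCurve ℚ) v 3 hv, localTamagawaNumber_eq_two_of_kodairaSymbolAt_eq_III_holds v _ hK]
  decide

/-- **`86700bq1`: `5 ∤ c_5(E)`** — the ♯ record's displayed binder `hcp` as a THEOREM: Kodaira type `II` at `5` (observatory certificate
`Step2Cert.sound` on the integer model, `decide`), hence `c_5 = 1` by the tree's discharged Tate-step fact
`localTamagawaNumber_eq_one_of_kodairaSymbolAt_eq_II`, read in Mathlib's `ℚ_5` via `localTamagawaNumber_padic_eq_holds`. [cite: SilvermanATAEC1994, IV.9.4 and Rem. IV.9.3]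
[cite: Cremona2006, Table 1 (Cremona label 86700bq1)] -/
theorem localTamagawaNumber_not_dvd_g86700bq1_5 : haveI := isElliptic_g86700bq1;
    ¬ 5 ∣ ((⟨0, 1, 0, (-327533), (-72432177)⟩ : WeierstrassCurve ℚ).baseChange ℚ_[5]).localTamagawaNumber ℤ_[5] := by
  haveI := isElliptic_g86700bq1
  haveI := isGloballyMinimal_g86700bq1
  have hb : (⟨0, 1, 0, (-327533), (-72432177)⟩ : WeierstrassCurve ℤ).baseChange ℚ = (⟨0, 1, 0, (-327533), (-72432177)⟩ : WeierstrassCurve ℚ) := by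
    ext <;> norm_num [WeierstrassCurve.baseChange, WeierstrassCurve.map]
  set v : HeightOneSpectrum (𝓞 ℚ) := (primesEquiv (R := 𝓞 ℚ)).symm ⟨5, by norm_num⟩ with hvdef
  have hv : ((primesEquiv v : Nat.Primes) : ℕ) = 5 := by rw [hvdef, Equiv.apply_symm_apply]
  have hgen : natGenerator v = 5 := hv
  haveI := perfectField_residueField_adicCompletionIntegers (K := ℚ) v
  have hK : (⟨0, 1, 0, (-327533), (-72432177)⟩ : WeierstrassCurve ℚ).kodairaSymbolAt v = .II := by
    have h := (Rank2Observatory.Tate.Step2Cert.sound (W₀ := (⟨0, 1, 0, (-327533), (-72432177)⟩ : WeierstrassCurve ℤ)) (c := ⟨5, 3, 0, 0, 2, 2, 0⟩) v hgen (by decide +kernel)).1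
    rw [hb] at h
    exact h.trans (by decide)
  rw [localTamagawaNumber_padic_eq_holds (⟨0, 1, 0, (-327533), (-72432177)⟩ : WeierstrassCurve ℚ) v 5 hv, localTamagawaNumber_eq_one_of_kodairaSymbolAt_eq_II_holds v _ hK]
  decide

/-- **`86700bv1`: `5 ∤ c_5(E)`** — the ♯ record's displayed binder `hcp` as a THEOREM: Kodaira type `IV*` at `5` (observatory certificate
`DeepCert.sound` on the integer model, `decide`), hence `c_5 = 1 or 3` by the tree's discharged Tate-step fact
`localTamagawaNumber_of_kodairaSymbolAt_eq_IVstar`, read in Mathlib's `ℚ_5` via `localTamagawaNumber_padic_eq_holds`. [cite: SilvermanATAEC1994, IV.9.4 and Rem. IV.9.3]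
[cite: Cremona2006, Table 1 (Cremona label 86700bv1)] -/
theorem localTamagawaNumber_not_dvd_g86700bv1_5 : haveI := isElliptic_g86700bv1;
    ¬ 5 ∣ ((⟨0, 1, 0, (-28333), (-1849537)⟩ : WeierstrassCurve ℚ).baseChange ℚ_[5]).localTamagawaNumber ℤ_[5] := by
  haveI := isElliptic_g86700bv1
  haveI := isGloballyMinimal_g86700bv1
  have hb : (⟨0, 1, 0, (-28333), (-1849537)⟩ : WeierstrassCurve ℤ).baseChange ℚ = (⟨0, 1, 0, (-28333), (-1849537)⟩ : WeierstrassCurve ℚ) := by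
    ext <;> norm_num [WeierstrassCurve.baseChange, WeierstrassCurve.map]
  set v : HeightOneSpectrum (𝓞 ℚ) := (primesEquiv (R := 𝓞 ℚ)).symm ⟨5, by norm_num⟩ with hvdef
  have hv : ((primesEquiv v : Nat.Primes) : ℕ) = 5 := by rw [hvdef, Equiv.apply_symm_apply]
  have hgen : natGenerator v = 5 := hv
  haveI := perfectField_residueField_adicCompletionIntegers (K := ℚ) v
  have hGM : ((⟨0, 1, 0, (-28333), (-1849537)⟩ : WeierstrassCurve ℤ).baseChange ℚ).IsGloballyMinimal := hb ▸ isGloballyMinimal_g86700bv1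
  have hK : (⟨0, 1, 0, (-28333), (-1849537)⟩ : WeierstrassCurve ℚ).kodairaSymbolAt v = .IVstar := by
    have h := (Rank2Observatory.Tate.DeepCert.sound (W₀ := (⟨0, 1, 0, (-28333), (-1849537)⟩ : WeierstrassCurve ℤ)) (c := ⟨5, 8, 0, 0, 8, 8, 0⟩) v hgen (hGM.isMinimal v) (by decide +kernel)).1
    rw [hb] at h
    exact h.trans (by decide)
  rw [localTamagawaNumber_padic_eq_holds (⟨0, 1, 0, (-28333), (-1849537)⟩ : WeierstrassCurve ℚ) v 5 hv]
  rcases localTamagawaNumber_of_kodairaSymbolAt_eq_IVstar_holds v _ hK with h | h <;> rw [h] <;> decide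

/-- **`93100bb1`: `5 ∤ c_5(E)`** — the ♯ record's displayed binder `hcp` as a THEOREM: Kodaira type `II` at `5` (observatory certificate
`Step2Cert.sound` on the integer model, `decide`), hence `c_5 = 1` by the tree's discharged Tate-step fact
`localTamagawaNumber_eq_one_of_kodairaSymbolAt_eq_II`, read in Mathlib's `ℚ_5` via `localTamagawaNumber_padic_eq_holds`. [cite: SilvermanATAEC1994, IV.9.4 and Rem. IV.9.3]
[cite: Cremona2006, Table 1 (Cremona label 93100bb1)] -/
theorem localTamagawaNumber_not_dvd_g93100bb1_5 : haveI := isElliptic_g93100bb1;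
    ¬ 5 ∣ ((⟨0, (-1), 0, 3092, (-91608)⟩ : WeierstrassCurve ℚ).baseChange ℚ_[5]).localTamagawaNumber ℤ_[5] := by
  haveI := isElliptic_g93100bb1
  haveI := isGloballyMinimal_g93100bb1
  have hb : (⟨0, (-1), 0, 3092, (-91608)⟩ : WeierstrassCurve ℤ).baseChange ℚ = (⟨0, (-1), 0, 3092, (-91608)⟩ : WeierstrassCurve ℚ) := by
    ext <;> norm_num [WeierstrassCurve.baseChange, WeierstrassCurve.map]
  set v : HeightOneSpectrum (𝓞 ℚ) := (primesEquiv (R := 𝓞 ℚ)).symm ⟨5, by norm_num⟩ with hvdef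
  have hv : ((primesEquiv v : Nat.Primes) : ℕ) = 5 := by rw [hvdef, Equiv.apply_symm_apply]
  have hgen : natGenerator v = 5 := hv
  haveI := perfectField_residueField_adicCompletionIntegers (K := ℚ) v
  have hK : (⟨0, (-1), 0, 3092, (-91608)⟩ : WeierstrassCurve ℚ).kodairaSymbolAt v = .II := by
    have h := (Rank2Observatory.Tate.Step2Cert.sound (W₀ := (⟨0, (-1), 0, 3092, (-91608)⟩ : WeierstrassCurve ℤ)) (c := ⟨5, 2, 0, 0, 2, 2, 0⟩) v hgen (by decide +kernel)).1
    rw [hb] at h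
    exact h.trans (by decide)
  rw [localTamagawaNumber_padic_eq_holds (⟨0, (-1), 0, 3092, (-91608)⟩ : WeierstrassCurve ℚ) v 5 hv, localTamagawaNumber_eq_one_of_kodairaSymbolAt_eq_II_holds v _ hK]
  decide

/-- **`93600de1`: `3 ∤ c_3(E)`** — the ♯ record's displayed binder `hcp` as a THEOREM: Kodaira type `III*` at `3` (observatory certificate
`DeepCert.sound` on the integer model, `decide`), hence `c_3 = 2` by the tree's discharged Tate-step fact
`localTamagawaNumber_eq_two_of_kodairaSymbolAt_eq_IIIstar`, read in Mathlib's `ℚ_3` via `localTamagawaNumber_padic_eq_holds`. [cite: SilvermanATAEC1994, IV.9.4 and Rem. IV.9.3]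
[cite: Cremona2006, Table 1 (Cremona label 93600de1)] -/
theorem localTamagawaNumber_not_dvd_g93600de1_3 : haveI := isElliptic_g93600de1;
    ¬ 3 ∣ ((⟨0, 0, 0, (-65880), (-6512400)⟩ : WeierstrassCurve ℚ).baseChange ℚ_[3]).localTamagawaNumber ℤ_[3] := by
  haveI := isElliptic_g93600de1
  haveI := isGloballyMinimal_g93600de1
  have hb : (⟨0, 0, 0, (-65880), (-6512400)⟩ : WeierstrassCurve ℤ).baseChange ℚ = (⟨0, 0, 0, (-65880), (-6512400)⟩ : WeierstrassCurve ℚ) := by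
    ext <;> norm_num [WeierstrassCurve.baseChange, WeierstrassCurve.map]
  set v : HeightOneSpectrum (𝓞 ℚ) := (primesEquiv (R := 𝓞 ℚ)).symm ⟨3, by norm_num⟩ with hvdef
  have hv : ((primesEquiv v : Nat.Primes) : ℕ) = 3 := by rw [hvdef, Equiv.apply_symm_apply]
  have hgen : natGenerator v = 3 := hv
  haveI := perfectField_residueField_adicCompletionIntegers (K := ℚ) v
  have hGM : ((⟨0, 0, 0, (-65880), (-6512400)⟩ : WeierstrassCurve ℤ).baseChange ℚ).IsGloballyMinimal := hb ▸ isGloballyMinimal_g93600de1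
  have hK : (⟨0, 0, 0, (-65880), (-6512400)⟩ : WeierstrassCurve ℚ).kodairaSymbolAt v = .IIIstar := by
    have h := (Rank2Observatory.Tate.DeepCert.sound (W₀ := (⟨0, 0, 0, (-65880), (-6512400)⟩ : WeierstrassCurve ℤ)) (c := ⟨3, 0, 0, 0, 9, 9, 0⟩) v hgen (hGM.isMinimal v) (by decide +kernel)).1
    rw [hb] at h
    exact h.trans (by decide)
  rw [localTamagawaNumber_padic_eq_holds (⟨0, 0, 0, (-65880), (-6512400)⟩ : WeierstrassCurve ℚ) v 3 hv, localTamagawaNumber_eq_two_of_kodairaSymbolAt_eq_IIIstar_holds v _ hK]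
  decide

end Summit.BirchSwinnertonDyer.BirchSwinnertonDyer.Theorems.TameUpperUnitTwistRecords
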